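import Mathlib
import Literature.Computability.Complexity.SymmetricCircuit
import Summits.PneNP.PneNP.Theses.ConvexRankGates
import Summits.PneNP.PneNP.Theorems.ConvexRankGatesConvexGateBlindCollapse

/-!
# PneNP / ConvexRankGates — `ConvexGateBlind` is a single-gate (psd-formulation) statement

Helpers (`--supports stmt-PneNP-10680`). By `circuit_collapse`, the crux `ConvexGateBlind`
(no polynomial-size `{∧₂, ∨₂} ∪ CONV_{m^c}` circuit computes `CLIQUE(m, ⌈m^δ⌉₊)`, some
`δ ∈ (0, 1/2)`, every `c`, eventually in `m`) is EQUIVALENT to its single-gate case: for some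
`δ ∈ (0, 1/2)` and every `c`, eventually NO single CONV gate `x ↦ [∃ Y ⪰ 0, tr(Aᵢ Y) ≤ bᵢ + (B 𝟙ₓ)ᵢ]`
with `B ≥ 0` and `p + q ≤ m^c`, reading the edge variables of `K_m`, computes `CLIQUE(m, ⌈m^δ⌉₊)`
(`convexGateBlind_of_singleGate`, `singleGate_of_convexGateBlind`). So the crux is exactly a
polynomial lower bound on the size of monotone psd formulations of the clique indicator — the
semidefinite version of the single weak-MLP-gate problem left open in Oliveira–Pudlák (ToCT 2019,
p. 3, §7.2); it closes nothing by itself.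
-/

namespace Summit.PneNP.PneNP.Theorems

open Matrix Finset

/-! ### The crux is a single-gate (psd-formulation) statement -/

section singleGate

open Literature.Computability.Complexity Filter
open scoped Classical

/-- Numeric bookkeeping: for `m ≥ 2`, `t ≤ m^c`, `n ≤ m^2`,
`4 (m^c + 1) (t + 1) (n + t + 2) ≤ m^(3c+8)`. [folklore] -/
theorem collapse_bound_pow {m c t n : ℕ} (hm : 2 ≤ m) (ht : t ≤ m ^ c) (hn : n ≤ m ^ 2) :
    4 * (m ^ c + 1) * (t + 1) * (n + t + 2) ≤ m ^ (3 * c + 8) := by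
  have hmc : 1 ≤ m ^ c := Nat.one_le_pow c m (by omega)
  have h1 : m ^ c + 1 ≤ 2 * m ^ c := by omega
  have h2 : t + 1 ≤ 2 * m ^ c := by omega
  have hc2 : m ^ 2 ≤ m ^ (c + 2) := Nat.pow_le_pow_right (by omega) (by omega)
  have hcc : m ^ c ≤ m ^ (c + 2) := Nat.pow_le_pow_right (by omega) (by omega)
  have h22 : 2 ≤ m ^ (c + 2) :=
    le_trans hm (by
      calc m = m ^ 1 := (pow_one m).symm
        _ ≤ m ^ (c + 2) := Nat.pow_le_pow_right (by omega) (by omega))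
  have h3 : n + t + 2 ≤ 3 * m ^ (c + 2) := by omega
  have h64 : 64 ≤ m ^ 6 := by
    calc 64 = 2 ^ 6 := by norm_num
      _ ≤ m ^ 6 := Nat.pow_le_pow_left hm 6
  calc 4 * (m ^ c + 1) * (t + 1) * (n + t + 2)
      ≤ 4 * (2 * m ^ c) * (2 * m ^ c) * (3 * m ^ (c + 2)) :=
        Nat.mul_le_mul (Nat.mul_le_mul (Nat.mul_le_mul le_rfl h1) h2) h3
    _ = 48 * (m ^ c * m ^ c * m ^ (c + 2)) := by ring
    _ ≤ m ^ 6 * (m ^ c * m ^ c * m ^ (c + 2)) := Nat.mul_le_mul_right _ (le_trans (by norm_num) h64)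
    _ = m ^ (3 * c + 8) := by ring

/-- The number of edge variables of `K_m` is at most `m^2` (local copy; the same fact is
`card_edgeSet_top_le` in `ConvexRankGatesConvexGateBlindOneGate.lean`). [folklore] -/
private theorem card_edgeSet_top_le' (m : ℕ) : Fintype.card ((⊤ : SimpleGraph (Fin m)).edgeSet) ≤ m ^ 2 := by
  calc Fintype.card ((⊤ : SimpleGraph (Fin m)).edgeSet)
      ≤ Fintype.card (Sym2 (Fin m)) := Fintype.card_le_of_injective Subtype.val Subtype.val_injective
    _ ≤ Fintype.card (Fin m × Fin m) :=
        Fintype.card_le_of_surjective (Sym2.mk (α := Fin m)).uncurry Sym2.mk_surjective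
    _ = m ^ 2 := by simp [sq]

/-- **The crux `ConvexGateBlind` follows from its single-gate case.** If for some `δ ∈ (0, 1/2)`
and every `c`, eventually in `m`, NO single CONV gate with `p + q ≤ m^c` reading the edge
variables of `K_m` directly computes `CLIQUE(m, ⌈m^δ⌉₊)` — i.e. the clique indicator has no
"psd formulation" `x ↦ [∃ Y ⪰ 0, tr(Aᵢ Y) ≤ bᵢ + (B 𝟙ₓ)ᵢ ∀ i]` with `B ≥ 0` of polynomial size —
then no polynomial-size `{∧₂, ∨₂} ∪ CONV` circuit computes it either (`circuit_collapse`; a bare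
output wire is the gate `0 ≤ -1 + [x_e]`). Together with `singleGate_of_convexGateBlind` this
identifies the crux with a psd-lift lower bound (cf. Oliveira–Pudlák, ToCT 2019, p. 3 and §7). [cite: OliveiraPudlak2019, Thm 4.3] -/
theorem convexGateBlind_of_singleGate
    (h : ∃ δ : ℝ, 0 < δ ∧ δ < 1 / 2 ∧ ∀ c : ℕ, ∀ᶠ m : ℕ in atTop, ∀ (p q : ℕ), p + q ≤ m ^ c →
      ∀ (A : Fin p → Matrix (Fin q) (Fin q) ℝ) (b : Fin p → ℝ)
        (B : Fin p → (⊤ : SimpleGraph (Fin m)).edgeSet → ℝ), (∀ i e, 0 ≤ B i e) →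
        ¬ ∀ x : (⊤ : SimpleGraph (Fin m)).edgeSet → Bool,
          decide (¬ (SimpleGraph.fromEdgeSet {e : Sym2 (Fin m) |
            ∃ h : e ∈ (⊤ : SimpleGraph (Fin m)).edgeSet, x ⟨e, h⟩ = true}).CliqueFree
              ⌈(m : ℝ) ^ δ⌉₊) = true ↔
          ∃ Y : Matrix (Fin q) (Fin q) ℝ, Y.PosSemidef ∧
            ∀ i, (A i * Y).trace ≤ b i + ∑ e, B i e * (if x e then (1 : ℝ) else 0)) :
    Summit.PneNP.PneNP.Theses.ConvexRankGates.ConvexGateBlind := by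
  obtain ⟨δ, hδ0, hδ1, hblind⟩ := h
  unfold Summit.PneNP.PneNP.Theses.ConvexRankGates.ConvexGateBlind
  refine ⟨δ, hδ0, hδ1, fun c => ?_⟩
  filter_upwards [hblind (3 * c + 8), eventually_ge_atTop 2] with m hm hm2 C hC hsize hcomp
  cases hout : C.output with
  | inl e₀ =>
    -- a bare output wire is the single CONV gate `0 ≤ -1 + [x e₀]` (`p = 1`, `q = 0`)
    refine hm 1 0 ?_ (fun _ => 0) (fun _ => -1) (fun _ e => if e = e₀ then 1 else 0) ?_ ?_
    · have := Nat.one_le_pow (3 * c + 8) m (by omega)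
      omega
    · intro i e
      show (0 : ℝ) ≤ if e = e₀ then 1 else 0
      split_ifs <;> norm_num
    · intro x
      have hcx := hcomp x
      dsimp only at hcx
      rw [← hcx, eval_eq_wireVal, hout]
      show x e₀ = true ↔ _
      have hsum : ∑ e, (if e = e₀ then (1 : ℝ) else 0) * (if x e then (1 : ℝ) else 0) =
          if x e₀ then (1 : ℝ) else 0 := by
        simp_rw [ite_mul, one_mul, zero_mul]
        rw [Finset.sum_ite_eq']
        simp
      constructor
      · intro hx
        refine ⟨0, Matrix.PosSemidef.zero, fun i => ?_⟩
        rw [Matrix.mul_zero, Matrix.trace_zero, hsum, if_pos hx]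
        norm_num
      · rintro ⟨Y, -, hY⟩
        have h0 := hY 0
        rw [hsum] at h0
        have htr : (((fun _ => 0 : Fin 1 → Matrix (Fin 0) (Fin 0) ℝ) 0) * Y).trace = 0 := by
          simp [Matrix.trace]
        rw [htr] at h0
        by_contra hx
        rw [if_neg hx] at h0
        norm_num at h0
  | inr mo =>
    obtain ⟨p, q, A, b, B, hpq, hB, hiff⟩ := circuit_collapse C hC hout
    refine hm p q (hpq.trans ?_) A b B hB ?_
    · exact collapse_bound_pow hm2 hsize (card_edgeSet_top_le' m)
    · intro x
      rw [← hiff x, hcomp x]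

/-- **Conversely, the single-gate case is a special case of the crux**: a single CONV gate reading
all edge variables is a size-`1` circuit over the basis (`Circuit.single`). [folklore] -/
theorem singleGate_of_convexGateBlind
    (h : Summit.PneNP.PneNP.Theses.ConvexRankGates.ConvexGateBlind) :
    ∃ δ : ℝ, 0 < δ ∧ δ < 1 / 2 ∧ ∀ c : ℕ, ∀ᶠ m : ℕ in atTop, ∀ (p q : ℕ), p + q ≤ m ^ c →
      ∀ (A : Fin p → Matrix (Fin q) (Fin q) ℝ) (b : Fin p → ℝ)
        (B : Fin p → (⊤ : SimpleGraph (Fin m)).edgeSet → ℝ), (∀ i e, 0 ≤ B i e) →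
        ¬ ∀ x : (⊤ : SimpleGraph (Fin m)).edgeSet → Bool,
          decide (¬ (SimpleGraph.fromEdgeSet {e : Sym2 (Fin m) |
            ∃ h : e ∈ (⊤ : SimpleGraph (Fin m)).edgeSet, x ⟨e, h⟩ = true}).CliqueFree
              ⌈(m : ℝ) ^ δ⌉₊) = true ↔
          ∃ Y : Matrix (Fin q) (Fin q) ℝ, Y.PosSemidef ∧
            ∀ i, (A i * Y).trace ≤ b i + ∑ e, B i e * (if x e then (1 : ℝ) else 0) := by
  unfold Summit.PneNP.PneNP.Theses.ConvexRankGates.ConvexGateBlind at h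
  obtain ⟨δ, hδ0, hδ1, hblind⟩ := h
  refine ⟨δ, hδ0, hδ1, fun c => ?_⟩
  filter_upwards [hblind c, eventually_ge_atTop 1] with m hm hm1 p q hpq A b B hB hgate
  -- the gate: arity `|E(K_m)|` (enumerated by `eE`), truth table = feasibility of the programme
  set eE := (Fintype.equivFin ((⊤ : SimpleGraph (Fin m)).edgeSet)).symm with heE
  refine hm (Circuit.single ⟨Fintype.card ((⊤ : SimpleGraph (Fin m)).edgeSet), fun u =>
      decide (∃ Y : Matrix (Fin q) (Fin q) ℝ, Y.PosSemidef ∧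
        ∀ i, (A i * Y).trace ≤ b i + ∑ j, B i (eE j) * (if u j then (1 : ℝ) else 0))⟩ eE) ?_ ?_ ?_
  · apply Circuit.single_isOver
    refine Set.mem_union_right _ ⟨p, q, hpq, A, b, fun i j => B i (eE j), fun i j => hB i _, fun u => ?_⟩
    exact decide_eq_true_iff
  · rw [Circuit.size_single]
    exact Nat.one_le_pow c m hm1
  · intro x
    rw [Circuit.eval_single, Bool.eq_iff_iff, hgate x]
    show decide _ = true ↔ _
    rw [decide_eq_true_iff]
    have hs : ∀ i, ∑ j, B i (eE j) * (if x (eE j) then (1 : ℝ) else 0) =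
        ∑ e, B i e * (if x e then (1 : ℝ) else 0) :=
      fun i => Equiv.sum_comp eE (fun e => B i e * (if x e then (1 : ℝ) else 0))
    simp only [hs]

end singleGate

end Summit.PneNP.PneNP.Theorems
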